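import Mathlib
import Summits.Ventures.PercRepro2.LocRows
import Summits.Ventures.PercRepro2.SwRow
import Summits.Ventures.PercRepro2.SwOut
import Summits.Ventures.PercRepro2.SwAllRow
import Summits.Ventures.PercRepro2.SwOutAll
import Summits.Ventures.PercRepro2.SwOutArmFlip
import Summits.Ventures.PercRepro2.SwOutArmThm
import Summits.Ventures.PercRepro2.SwOutCoreDefs
import Summits.Ventures.PercRepro2.SwOutShadowDefs
import Summits.Ventures.PercRepro2.SwOutCoreShadowDefs
import Summits.Ventures.PercRepro2.SwOutCoreShadowFlip
import Summits.Ventures.PercRepro2.SwOutEdgeDefs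
import Summits.Ventures.PercRepro2.SwOutEdgeShadow

/-!
# The shadow cube of a one-sided point of an e-core cube, as flips of core-cube points (blind
cell PercRepro2, night-4 g16, 2026-08-26; proofs/NIGHT4-G15.md §4 (L4), proofs/NIGHT4-G16.md §3)

The flip algebra of `SwOutCoreShadowFlip` for an e-core base (the junction `u` adjacent to `h`):
the shadow base satisfies `flip (sX ∪ sZ) (shadowOf ζ) = flip sX (flip sZ ζ)` and every shadow
point is a flip of an arm-cube point `coreReal ζ ω` of the base — the X-blue half `flip sX` of
the core points coloured as `ω₀` on the u-adjacent arms, the X-red half `flip (sX ∪ sZ) ∘ flip sX`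
of them.  The h–u edges are carried along by `sX ∋ u` (they are flipped exactly when `sX` is).  The
arm-cube points of an e-core base are its e-cube points with the h–u edges red
(`coreRealE_withHuRed`), which is how these statements read on the e-cube.
-/

namespace Summit.Ventures.PercRepro2

namespace LocRows

open Hull

variable {V : Type*} {E : Type*}

open scoped Classical

variable {ends : E → Sym2 V}

section Bridge

variable {ι : Type*} {A : ι → Set V} {pure : ι → Prop} {ζ : Config E} {h u : V} {H : Set V}
  (hb : CoreBaseE ends ζ h u H A pure)
include hb

/-- **An arm-cube point of an e-core base is its e-cube point with the h–u edges red.** -/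
theorem CoreBaseE.coreRealE_withHuRed (ω : Config ι) :
    coreRealE ends A h u ζ (withHuRed ω) = coreReal ends A ζ ω := by
  funext e
  by_cases hhu : ends e = s(h, u)
  · rw [CoreBaseE.coreRealE_apply_hu (A := A) (ζ := ζ) hhu, withHuRed_none, if_pos rfl,
      CoreBase.coreReal_apply_of_notMem (hb.hu_not_touches hhu)]
  · simp only [coreRealE, if_neg hhu, withHuRed_comp_some]

end Bridge

section Flip

variable {ι : Type*} {A : ι → Set V} {pure : ι → Prop} {ζ : Config E} {h u : V} {H : Set V}
  (hb : CoreBaseE ends ζ h u H A pure) {ω₀ : Config ι}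
include hb

/-- An edge touching both `sX` and `sZ` joins `u` to a dropped arm. -/
lemma CoreBaseE.uZ_of_touches_sX_sZ {e : E} (hX : e ∈ touches ends (sX ends u A ω₀))
    (hZ : e ∈ touches ends (sZ ends u A ω₀)) : ∃ z ∈ sZ ends u A ω₀, ends e = s(u, z) := by
  obtain ⟨x, hx, y, hxy⟩ := hX
  obtain ⟨z, hz, w, hzw⟩ := hZ
  obtain ⟨j, hj, hωj, hzj⟩ := hz
  have hzX : z ∉ sX ends u A ω₀ := by
    intro hzX
    rcases mem_sX_iff.1 hzX with rfl | ⟨i, _, hωi, hzi⟩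
    · exact hb.u_notMem_arm j hzj
    · have : i = j := by
        by_contra hne
        exact hb.arm_disj i j hne z hzi hzj
      subst this
      rw [hωi] at hωj; exact absurd hωj (by decide)
  rw [hxy, Sym2.eq_iff] at hzw
  rcases hzw with ⟨h1, _⟩ | ⟨_, h2⟩
  · exact absurd (h1 ▸ hx) hzX
  · -- `y = z ∈ A j`, `x ∈ sX`: the edge leaves from `u`
    rw [← h2] at hzj
    have hxu : x = u := hb.eq_u_of_edge_sX hxy hx hzj (fun h' => by
      rw [h'.2] at hωj; exact absurd hωj (by decide))
    subst hxu
    exact ⟨y, ⟨j, hj, hωj, hzj⟩, hxy⟩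

/-- **`flip (sX ∪ sZ) (shadowOf ζ) = flip sX (flip sZ ζ)`.** -/
theorem CoreBaseE.flip_sXZ_shadowOf :
    flip ends (sX ends u A ω₀ ∪ sZ ends u A ω₀) (shadowOf ends u A ω₀ ζ) =
      flip ends (sX ends u A ω₀) (flip ends (sZ ends u A ω₀) ζ) := by
  funext e
  by_cases hX : e ∈ touches ends (sX ends u A ω₀) <;> by_cases hZ : e ∈ touches ends (sZ ends u A ω₀)
  · obtain ⟨z, hz, he⟩ := hb.uZ_of_touches_sX_sZ hX hZ
    rw [flip_apply_of_mem (touches_mono Set.subset_union_left hX), shadowOf_apply_of_mem_sZ hz he,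
      flip_apply_of_mem hX, flip_apply_of_mem hZ]
  · have hnot : ¬ ∃ z ∈ sZ ends u A ω₀, ends e = s(u, z) := by
      rintro ⟨z, hz, he⟩
      exact hZ (CoreBase.touches_of_uZ hz he).2
    rw [flip_apply_of_mem (touches_mono Set.subset_union_left hX), shadowOf_apply_of_not hnot,
      flip_apply_of_mem hX, flip_apply_of_notMem hZ]
  · have hnot : ¬ ∃ z ∈ sZ ends u A ω₀, ends e = s(u, z) := by
      rintro ⟨z, hz, he⟩
      exact hX (CoreBase.touches_of_uZ hz he).1
    rw [flip_apply_of_mem (touches_mono Set.subset_union_right hZ), shadowOf_apply_of_not hnot,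
      flip_apply_of_notMem hX, flip_apply_of_mem hZ]
  · have hnot : ¬ ∃ z ∈ sZ ends u A ω₀, ends e = s(u, z) := by
      rintro ⟨z, hz, he⟩
      exact hX (CoreBase.touches_of_uZ hz he).1
    rw [flip_apply_of_notMem, shadowOf_apply_of_not hnot, flip_apply_of_notMem hX,
      flip_apply_of_notMem hZ]
    rintro ⟨x, hx, y, hxy⟩
    rcases hx with hx | hx
    · exact hX ⟨x, hx, y, hxy⟩
    · exact hZ ⟨x, hx, y, hxy⟩

/-- No edge joins a far arm to `sX ∪ sZ`. -/
lemma CoreBaseE.not_touches_far_sXZ (ω' : Config (Option {i : ι // ¬ uAdjC ends u A i})) :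
    ∀ e, e ∈ touches ends (farFalse (A := A) ω') →
      e ∈ touches ends (sX ends u A ω₀ ∪ sZ ends u A ω₀) → False := by
  rintro e ⟨x, ⟨i, _, hxi⟩, y, hxy⟩ ⟨z, hz, w, hzw⟩
  have hzi : z ∉ A i.1 := by
    intro hzi
    rcases hz with hz | hz
    · rcases mem_sX_iff.1 hz with rfl | ⟨j, hj, _, hzj⟩
      · exact hb.u_notMem_arm i.1 hzi
      · have : i.1 = j := by
          by_contra hne
          exact hb.arm_disj i.1 j hne z hzi hzj
        exact i.2 (this ▸ hj)
    · obtain ⟨j, hj, _, hzj⟩ := hz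
      have : i.1 = j := by
        by_contra hne
        exact hb.arm_disj i.1 j hne z hzi hzj
      exact i.2 (this ▸ hj)
  rw [hxy, Sym2.eq_iff] at hzw
  rcases hzw with ⟨h1, _⟩ | ⟨_, h2⟩
  · exact hzi (h1 ▸ hxi)
  · -- `z = y` is joined to `x ∈ A i`: `z ∈ sX ∪ sZ`, so `z = u` or `z` in a u-adjacent arm
    rw [← h2] at hz
    rcases hz with hz | hz
    · rcases mem_sX_iff.1 hz with rfl | ⟨j, hj, _, hyj⟩
      · exact i.2 ⟨e, x, ends_swap hxy, hxi⟩
      · have : i.1 = j := hb.arm_eq_of_edge hxy hxi hyj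
        exact i.2 (this ▸ hj)
    · obtain ⟨j, hj, _, hyj⟩ := hz
      have : i.1 = j := hb.arm_eq_of_edge hxy hxi hyj
      exact i.2 (this ▸ hj)

/-- **The X-blue half of the shadow cube**: the shadow point with `none ↦ false` and the far
colouring of a core point `ω` (agreeing with `ω₀` on the u-adjacent arms) is `flip sX` of that
core point — the state `ζ_b`. -/
theorem CoreBaseE.shadowReal_eq_flip_coreReal_false (ω : Config ι)
    (hω : ∀ i, uAdjC ends u A i → ω i = ω₀ i)
    (ω' : Config (Option {i : ι // ¬ uAdjC ends u A i})) (hnone : ω' none = false)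
    (hω' : ∀ i, ω' (some i) = ω i.1) :
    shadowReal ends (sB ends u A ω₀) (sZ ends u A ω₀) none (shadowOf ends u A ω₀ ζ) ω' =
      flip ends (sX ends u A ω₀) (coreReal ends A ζ ω) := by
  unfold shadowReal coreReal
  rw [shadowFalse_eq, CoreBase.armsFalseC_eq ω hω ω' hω']
  have hset : {x | ω' none = false ∧ x ∈ sX ends u A ω₀ ∪ sZ ends u A ω₀} =
      sX ends u A ω₀ ∪ sZ ends u A ω₀ := by
    ext x; simp [hnone]
  rw [hset, flip_union_of_not_both (hb.not_touches_far_sXZ ω'), hb.flip_sXZ_shadowOf,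
    flip_union_of_not_both (fun e h1 h2 => hb.not_touches_far_sXZ ω' e h1
      (touches_mono Set.subset_union_right h2)), flip_comm (farFalse ω')]

/-- **The X-red half of the shadow cube**: the shadow point with `none ↦ true` and the far
colouring of a core point `ω` (agreeing with `ω₀` on the u-adjacent arms) is
`flip (sX ∪ sZ) (flip sX _)` of that core point — the state `ζ_o`. -/
theorem CoreBaseE.shadowReal_eq_flip_coreReal_true (ω : Config ι)
    (hω : ∀ i, uAdjC ends u A i → ω i = ω₀ i)
    (ω' : Config (Option {i : ι // ¬ uAdjC ends u A i})) (hnone : ω' none = true)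
    (hω' : ∀ i, ω' (some i) = ω i.1) :
    shadowReal ends (sB ends u A ω₀) (sZ ends u A ω₀) none (shadowOf ends u A ω₀ ζ) ω' =
      flip ends (sX ends u A ω₀ ∪ sZ ends u A ω₀)
        (flip ends (sX ends u A ω₀) (coreReal ends A ζ ω)) := by
  unfold shadowReal coreReal
  rw [shadowFalse_eq, CoreBase.armsFalseC_eq ω hω ω' hω']
  have hset : {x | ω' none = false ∧ x ∈ sX ends u A ω₀ ∪ sZ ends u A ω₀} = (∅ : Set V) := by
    ext x; simp [hnone]
  rw [hset, Set.union_empty,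
    flip_union_of_not_both (fun e h1 h2 => hb.not_touches_far_sXZ ω' e h1
      (touches_mono Set.subset_union_right h2)), flip_comm (sX ends u A ω₀),
    flip_comm (sX ends u A ω₀ ∪ sZ ends u A ω₀), ← hb.flip_sXZ_shadowOf, Hull.flip_flip]

end Flip

end LocRows

end Summit.Ventures.PercRepro2
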